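import Summits.QuantumFields.BalabanUV.T4Continuum.Support.RegionGaugeColumnsRegion

/-!
# T⁴ programme, spine node NE2 (U1a), sub-row Δ1 «NE2⁰-Dirichlet» — THE RATE ALGEBRA OF A DISPLAYED CORNER-MASS GROWTH:
# `τ_k ≤ A·n_k^σ` (`0 ≤ σ < 1`) FEEDS THE TWO RATE BINDERS OF THE RE-ENTRANT ENDs AT `θ = L^{−(1−σ)/2}`

NE2 formalisation swarm `b2b-balaban-t4-ne2-formalise-*`, LEAF PROVER 09 (gen 10), bookkeeping brick for the re-entrant front (journal
`HOME/CLAIMS.log` 2026-08-21 l.23790 / l.24724; memo `t4/T4-EST-NE2-D1-CORNER.md` §3; owner R42 (c): «state region bricks with level-dependent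
constants and a displayed growth rate»).  This seat's ENDs `RegionGaugeResolventTowerMonotone.hinjK_of_local_of_cornerMass_monotone[_slice]`
∕ `hinjK_boxHole_of_local_of_cornerMass` display, besides the local leaf (L), the corner-mass growth `τ : ℕ → ℝ` of the scalar region
Dirichlet solution through THREE binders:
`hθ : (√L)⁻¹ ≤ θ`, `hrate : ∀ k, √(2(Λ + 2(d−1)τ_k)/n_k) ≤ CH·θ^k`, `hrateB : ∀ k, √(CgaugeRsq d L a′ (Λ + 2(d−1)τ_k) (Λm + 2(d−1)τ_k))·(√n_k)⁻¹ ≤ CB·θ^k`.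
THIS FILE discharges all three from ONE displayed growth law **`τ_k ≤ A·n_k^σ`** with `0 ≤ σ` (useful for `σ < 1`), at the rate
**`θ_σ := (L^{(1−σ)/2})⁻¹`** and the explicit constants `CH = √(2(Λ + cA))`, `CB = √(CgaugeRsq d L a′ (Λ + cA) (Λm + cA))` (`c ≥ 0` the
corner coefficient, `2(d−1)` in the ENDs):
 * `rpow_lev_eq` (`n_k^{(σ−1)/2} = θ_σ^k`), `sqrtL_inv_le_rateTheta` (`(√L)⁻¹ ≤ θ_σ` iff-free: from `0 ≤ σ`), `rateTheta_lt_one` (`θ_σ < 1`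
   for `σ < 1 < L`), `rateTheta_pos`;
 * `CgaugeRsq_le_mul` (the gauge-columns constant is affine-monotone: budgets scaled by `s ≥ 1` scale it by at most `s`);
 * **`hrate_of_growth`**, **`hrateB_of_growth`** — the two rate binders, token for token, from the growth law.
So on the re-entrant class the ENDs' displayed scalar data reduce to `(A, σ)` with `σ < 1`: the honest wall of memo §3 («rates decay iff
`τ_{n_k} = o(n_k)`»; trivially `σ = 2`, Rellich `σ = 1` = no decay, expected truth `σ = 2/3`) is now a binder of the kernel.

HONEST FRAMING (T4-DAG p. 1).  [folklore] real-number bookkeeping (`rpow`, `sqrt`); NO bound on `τ` is proved; nothing about [B9]'s printed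
regions; `hinjK` ∕ W3 off boxes OPEN; Δ1 NOT closed; NE2 (U1a) NOT proved; spine PROVED 0/9 unchanged; NOT infinite volume, NOT a mass gap,
NOT the Clay problem.  HONEST DEPENDENCY: continuum YM on T⁴ ⇐ BetaPertH ∧ nine spine estimates (0/9 proved); BetaPertH ⇐ (D1) ∧ (D4) ∧
CAP+tail; G-an2-4 gates asym, D1 and NE2/3/4.  No `sorry`.
-/

noncomputable section

namespace Summit.QuantumFields.BalabanUV.T4Continuum.DirichletCornerMassRates

open Literature.MathematicalPhysics.QuantumFieldTheory.Balaban1983to89.B5G183RateUnitTower (lev)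
open Summit.QuantumFields.BalabanUV.T4Continuum
open Summit.QuantumFields.BalabanUV.T4Continuum.ScalarAveragedPropagator (gammaPs)
open Summit.QuantumFields.BalabanUV.T4Continuum.RegionGaugeColumnsRegion (CgaugeRsq)
open Summit.QuantumFields.BalabanUV.T4Continuum.BalabanAveragedTowerUnit (cast_lev' one_le_lev')

variable {d : ℕ} (L : ℕ) [NeZero L]

/-! ## §1 The rate `θ_σ = (L^{(1−σ)/2})⁻¹` and the levels -/

/-- `0 < θ_σ`. [folklore] -/
theorem rateTheta_pos (σ : ℝ) : 0 < ((L : ℝ) ^ ((1 - σ) / 2))⁻¹ :=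
  inv_pos.mpr (Real.rpow_pos_of_pos (by exact_mod_cast Nat.pos_of_ne_zero (NeZero.ne L)) _)

omit [NeZero L] in
/-- `θ_σ = L^{(σ−1)/2}`. [folklore] -/
theorem rateTheta_eq (σ : ℝ) : ((L : ℝ) ^ ((1 - σ) / 2))⁻¹ = (L : ℝ) ^ ((σ - 1) / 2) := by
  rw [← Real.rpow_neg (Nat.cast_nonneg L)]
  congr 1
  ring

omit [NeZero L] in
/-- **`n_k^{(σ−1)/2} = θ_σ^k`** (`n_k = L^k`). [folklore] -/
theorem rpow_lev_eq (σ : ℝ) (k : ℕ) : ((lev L k : ℕ) : ℝ) ^ ((σ - 1) / 2) = (((L : ℝ) ^ ((1 - σ) / 2))⁻¹) ^ k := by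
  rw [rateTheta_eq, cast_lev', ← Real.rpow_natCast, ← Real.rpow_mul (Nat.cast_nonneg L), mul_comm,
    Real.rpow_mul (Nat.cast_nonneg L), Real.rpow_natCast]

omit [NeZero L] in
/-- **`(√L)⁻¹ ≤ θ_σ` for `0 ≤ σ`** (`L ≥ 1`): the ENDs' binder `hθ`. [folklore] -/
theorem sqrtL_inv_le_rateTheta (hL : 1 ≤ L) {σ : ℝ} (hσ : 0 ≤ σ) : (Real.sqrt (L : ℝ))⁻¹ ≤ ((L : ℝ) ^ ((1 - σ) / 2))⁻¹ := by
  have hL' : (1 : ℝ) ≤ (L : ℝ) := by exact_mod_cast hL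
  rw [rateTheta_eq, Real.sqrt_eq_rpow, ← Real.rpow_neg (Nat.cast_nonneg L)]
  exact Real.rpow_le_rpow_of_exponent_le hL' (by linarith)

omit [NeZero L] in
/-- `θ_σ < 1` for `σ < 1 < L`. [folklore] -/
theorem rateTheta_lt_one (hL : 1 < L) {σ : ℝ} (hσ : σ < 1) : ((L : ℝ) ^ ((1 - σ) / 2))⁻¹ < 1 := by
  have hL' : (1 : ℝ) < (L : ℝ) := by exact_mod_cast hL
  rw [rateTheta_eq]
  exact Real.rpow_lt_one_of_one_lt_of_neg hL' (by linarith)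

/-- `1 ≤ n_k^σ` for `0 ≤ σ`. [folklore] -/
theorem one_le_rpow_lev {σ : ℝ} (hσ : 0 ≤ σ) (k : ℕ) : 1 ≤ ((lev L k : ℕ) : ℝ) ^ σ :=
  Real.one_le_rpow (by exact_mod_cast one_le_lev' L k) hσ

/-- the `sqrt`∕`rpow` step: `√(n^σ·C)·(√n)⁻¹ = √C·n^{(σ−1)/2}` (`0 < n`). [folklore] -/
theorem sqrt_rpow_mul_mul_inv_sqrt {n C : ℝ} (σ : ℝ) (hn : 0 < n) :
    Real.sqrt (n ^ σ * C) * (Real.sqrt n)⁻¹ = Real.sqrt C * n ^ ((σ - 1) / 2) := by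
  rw [Real.sqrt_mul (Real.rpow_nonneg hn.le σ), Real.sqrt_eq_rpow (n ^ σ), Real.sqrt_eq_rpow n, Real.sqrt_eq_rpow C,
    ← Real.rpow_mul hn.le, ← Real.rpow_neg hn.le, mul_right_comm, ← Real.rpow_add hn, mul_comm]
  congr 2
  ring

/-! ## §2 The rate binder `hrate` from the growth law -/

/-- **`hrate` FROM THE GROWTH LAW**: `τ_k ≤ A·n_k^σ` (`0 ≤ Λ, c, A, σ`) ⟹
`√(2(Λ + c·τ_k)/n_k) ≤ √(2(Λ + cA))·θ_σ^k`. [folklore] -/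
theorem hrate_of_growth {Λ c A σ : ℝ} (hΛ : 0 ≤ Λ) (hc : 0 ≤ c) (hA : 0 ≤ A) (hσ : 0 ≤ σ) {τ : ℕ → ℝ}
    (hτ : ∀ k, τ k ≤ A * ((lev L k : ℕ) : ℝ) ^ σ) (k : ℕ) :
    Real.sqrt (2 * (Λ + c * τ k) / ((lev L k : ℕ) : ℝ)) ≤ Real.sqrt (2 * (Λ + c * A)) * (((L : ℝ) ^ ((1 - σ) / 2))⁻¹) ^ k := by
  have hn : 0 < ((lev L k : ℕ) : ℝ) := by exact_mod_cast one_le_lev' L k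
  have h1 := one_le_rpow_lev L hσ k
  set n : ℝ := ((lev L k : ℕ) : ℝ) with hn_def
  -- `Λ + cτ_k ≤ (Λ + cA)·n^σ`
  have hnum : 2 * (Λ + c * τ k) ≤ n ^ σ * (2 * (Λ + c * A)) := by
    have hcτ : c * τ k ≤ c * (A * n ^ σ) := mul_le_mul_of_nonneg_left (hτ k) hc
    have hΛ' : Λ ≤ Λ * n ^ σ := le_mul_of_one_le_right hΛ h1
    nlinarith
  have hle : 2 * (Λ + c * τ k) / n ≤ n ^ σ * (2 * (Λ + c * A)) / n := div_le_div_of_nonneg_right hnum hn.le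
  refine (Real.sqrt_le_sqrt hle).trans (le_of_eq ?_)
  rw [← rpow_lev_eq, ← hn_def, div_eq_mul_inv, Real.sqrt_mul (by positivity), Real.sqrt_inv,
    sqrt_rpow_mul_mul_inv_sqrt σ hn]

/-! ## §3 The rate binder `hrateB` from the growth law -/

omit [NeZero L] in
/-- **THE GAUGE-COLUMNS CONSTANT IS AFFINE-MONOTONE**: budgets dominated by `s`-multiples (`s ≥ 1`) of two budgets give at most `s` times
the constant. [folklore] -/
theorem CgaugeRsq_le_mul (a' : ℝ) {s Λ₁ Λ₂ Λm₁ Λm₂ : ℝ} (hs : 1 ≤ s) (hΛ : Λ₁ ≤ s * Λ₂) (hΛm : Λm₁ ≤ s * Λm₂) : CgaugeRsq d L a' Λ₁ Λm₁ ≤ s * CgaugeRsq d L a' Λ₂ Λm₂ := by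
  unfold CgaugeRsq
  have h0 : 0 ≤ a' ^ 2 * ((gammaPs d a')⁻¹) ^ 2 * (d : ℝ) := by positivity
  have hd0 : 0 ≤ 2 * (d : ℝ) * (L : ℝ) ^ 2 := by positivity
  have hd1 : 0 ≤ 16 * (d : ℝ) ^ 2 * (L : ℝ) ^ 2 := by positivity
  have e1 : 2 * (d : ℝ) * (L : ℝ) ^ 2 * Λm₁ ≤ s * (2 * (d : ℝ) * (L : ℝ) ^ 2 * Λm₂) := by nlinarith [mul_le_mul_of_nonneg_left hΛm hd0]
  have e2 : 16 * (d : ℝ) ^ 2 * (L : ℝ) ^ 2 * Λ₁ ≤ s * (16 * (d : ℝ) ^ 2 * (L : ℝ) ^ 2 * Λ₂) := by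
    nlinarith [mul_le_mul_of_nonneg_left hΛ hd1]
  have e3 : a' ^ 2 * ((gammaPs d a')⁻¹) ^ 2 * (d : ℝ) ≤ s * (a' ^ 2 * ((gammaPs d a')⁻¹) ^ 2 * (d : ℝ)) :=
    le_mul_of_one_le_left h0 hs
  nlinarith

/-- **`hrateB` FROM THE GROWTH LAW**: `τ_k ≤ A·n_k^σ` (`0 ≤ Λ, Λm, c, A, σ`) ⟹
`√(CgaugeRsq d L a′ (Λ + cτ_k) (Λm + cτ_k))·(√n_k)⁻¹ ≤ √(CgaugeRsq d L a′ (Λ + cA) (Λm + cA))·θ_σ^k`. [folklore] -/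
theorem hrateB_of_growth (a' : ℝ) {Λ Λm c A σ : ℝ} (hΛ : 0 ≤ Λ) (hΛm : 0 ≤ Λm) (hc : 0 ≤ c) (hA : 0 ≤ A) (hσ : 0 ≤ σ) {τ : ℕ → ℝ}
    (hτ : ∀ k, τ k ≤ A * ((lev L k : ℕ) : ℝ) ^ σ) (k : ℕ) :
    Real.sqrt (CgaugeRsq d L a' (Λ + c * τ k) (Λm + c * τ k)) * (Real.sqrt ((lev L k : ℕ) : ℝ))⁻¹
      ≤ Real.sqrt (CgaugeRsq d L a' (Λ + c * A) (Λm + c * A)) * (((L : ℝ) ^ ((1 - σ) / 2))⁻¹) ^ k := by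
  have hn : 0 < ((lev L k : ℕ) : ℝ) := by exact_mod_cast one_le_lev' L k
  have h1 := one_le_rpow_lev L hσ k
  set n : ℝ := ((lev L k : ℕ) : ℝ) with hn_def
  have hcA : 0 ≤ c * A := mul_nonneg hc hA
  have hcτ : c * τ k ≤ c * (A * n ^ σ) := mul_le_mul_of_nonneg_left (hτ k) hc
  have hΛ' : Λ ≤ Λ * n ^ σ := le_mul_of_one_le_right hΛ h1
  have hΛm' : Λm ≤ Λm * n ^ σ := le_mul_of_one_le_right hΛm h1
  have hC : CgaugeRsq d L a' (Λ + c * τ k) (Λm + c * τ k) ≤ n ^ σ * CgaugeRsq d L a' (Λ + c * A) (Λm + c * A) :=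
    CgaugeRsq_le_mul L a' h1 (by nlinarith) (by nlinarith)
  calc Real.sqrt (CgaugeRsq d L a' (Λ + c * τ k) (Λm + c * τ k)) * (Real.sqrt n)⁻¹
      ≤ Real.sqrt (n ^ σ * CgaugeRsq d L a' (Λ + c * A) (Λm + c * A)) * (Real.sqrt n)⁻¹ :=
        mul_le_mul_of_nonneg_right (Real.sqrt_le_sqrt hC) (inv_nonneg.mpr (Real.sqrt_nonneg _))
    _ = Real.sqrt (CgaugeRsq d L a' (Λ + c * A) (Λm + c * A)) * (((L : ℝ) ^ ((1 - σ) / 2))⁻¹) ^ k := by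
        rw [sqrt_rpow_mul_mul_inv_sqrt σ hn, ← rpow_lev_eq]

end Summit.QuantumFields.BalabanUV.T4Continuum.DirichletCornerMassRates

end
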